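import Literature.NumberTheory.Automorphic.ResGLnKugaHarmonic
import Literature.NumberTheory.Automorphic.MixedSpaceTraceDual
import Literature.Algebra.Lie.CasimirElement
import HarnessLib

/-!
# The canonical tensor of the trace form of `𝔤𝔩ₙ(K_∞)` pushed along two embeddings

Topic `NumberTheory/Automorphic`; namespaces `Literature.NumberTheory.Automorphic.ResGLnCartan`
(sequel of `ResGLnCartanData`) and `…ConeDictionary` (re-typing over the datum).  Definitions with
bodies and theorems; no named fact, no `sorry`.

For the real trace form `B(X, Y) = Tr_{K_∞/ℝ} tr(XY)` on `𝔤 = 𝔤𝔩ₙ(K_∞)` and its canonical tensor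
`T = ∑_t b_t ⊗ b^t` (any basis; here the adapted basis of `ResGLnCartanData` and its dual):

* `matBasis` — the basis `E_{ab} e_s` of `𝔤` from the standard basis `e` of `K_∞`
  (`MixedTraceDual.e`, `Module.Basis.matrix`), and `matDual` — the family `E_{ba} e^s`, which IS its
  `B`-dual basis (`trForm_matDual_matBasis`, `dualBasis_matBasis`);
* `mapEmb τ : 𝔤 →ₗ[ℝ] 𝔤𝔩ₙ(ℂ)` — `X ↦ τ̃(X)` entrywise, `map_single`;
* **`sum_bilin_map_adaptedBasis_dualB`** — for a real-bilinear `Ψ` on `𝔤𝔩ₙ(ℂ)` which is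
  complex-homogeneous in each variable,
  `∑_t Ψ(τ̃ b_t, τ̃' b^t) = δ_{τ,τ'} ∑_{a,b} Ψ(E_{ab}, E_{ba})`
  (basis independence `Literature.Algebra.Lie.sum_basis_dualBasis_eq` to pass to `matBasis`, then
  the orthogonality of the embeddings `MixedTraceDual.sum_embeddingExt_e_mul_eDual`);
* `ConeDictionary.sum_bilin_map_bD_dD` — the same over the datum (`bD`, `dD`).

This is the tensor identity behind `C_{E_λ} = ∑_τ 1 ⊗ ⋯ ⊗ C^alg_{λ_τ} ⊗ ⋯ ⊗ 1`
(`ResGLnKugaCasimirScalarE`). [cite: BorelWallach2000, I §2.3]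

## References

* A. Borel, N. Wallach (2000), I §2.3 (held). [BorelWallach2000]
-/

noncomputable section

namespace Literature.NumberTheory.Automorphic

-- Mathlib idiom (as in `GKModules`): commutator bracket on matrix algebras and `Module.End`
attribute [local instance 100] LieRing.ofAssociativeRing

-- `Classical`: the place subtypes indexing `mixedSpace K` are `Fintype` classically (as in `AdelicGLnGlue`).
open scoped TensorProduct Classical _root_.Matrix ComplexConjugate
open _root_.NumberField _root_.NumberField.InfinitePlace _root_.NumberField.mixedEmbedding Finset

namespace ResGLnCartan

variable (n : ℕ) (K : Type) [Field K] [NumberField K]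

/-! ### The matrix basis of `𝔤` and its trace-dual -/

/-- `𝔤 ≃ Matrix (Fin n) (Fin n) K_∞` (all matrices). [folklore] -/
def matEquiv : Matrix (Fin n) (Fin n) (mixedSpace K) ≃ₗ[ℝ] 𝔤 n K :=
  { toFun := ofMatrix
    invFun := fun X => (X : Matrix (Fin n) (Fin n) (mixedSpace K))
    map_add' := fun _ _ => rfl
    map_smul' := fun _ _ => rfl
    left_inv := fun _ => rfl
    right_inv := fun _ => rfl }

/-- **The basis `E_{ab} e_s` of `𝔤`** (`e` the standard basis of `K_∞`). [folklore] -/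
def matBasis : Module.Basis (Fin n × Fin n × index K) ℝ (𝔤 n K) :=
  ((stdBasis K).matrix (Fin n) (Fin n)).map (matEquiv n K)

/-- Its elements. [folklore] -/
theorem matBasis_apply (a b : Fin n) (s : index K) :
    matBasis n K (a, b, s) = ofMatrix (Matrix.single a b (MixedTraceDual.e K s)) := by
  rw [matBasis, Module.Basis.map_apply, Module.Basis.matrix_apply, MixedTraceDual.stdBasis_eq_e]
  rfl

/-- **The family `E_{ba} e^s`** (`e^s` the trace-dual family of `K_∞`). [folklore] -/
def matDual (t : Fin n × Fin n × index K) : 𝔤 n K :=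
  ofMatrix (Matrix.single t.2.1 t.1 (MixedTraceDual.eDual K t.2.2))

/-- Its elements. [folklore] -/
theorem matDual_apply (a b : Fin n) (s : index K) :
    matDual n K (a, b, s) = ofMatrix (Matrix.single b a (MixedTraceDual.eDual K s)) := rfl

/-- `B(E_{b'a'} y, E_{ab} x) = δ_{aa'} δ_{bb'} Tr(yx)`. [folklore] -/
theorem trForm_single_single (a b a' b' : Fin n) (x y : mixedSpace K) :
    trForm n K (ofMatrix (Matrix.single b' a' y)) (ofMatrix (Matrix.single a b x)) =
      if a = a' ∧ b = b' then mixedTrace K (y * x) else 0 := by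
  rw [trForm_apply, coe_ofMatrix, coe_ofMatrix, Matrix.trace_single_mul, Matrix.single_apply, smul_eq_mul, mul_ite,
    mul_zero, apply_ite (mixedTrace K), map_zero]

/-- **`matDual` is `B`-dual to `matBasis`**: `B(E_{ba} e^s, E_{a'b'} e_{s'}) = δ`. [folklore] -/
theorem trForm_matDual_matBasis (t t' : Fin n × Fin n × index K) :
    trForm n K (matDual n K t) (matBasis n K t') = if t' = t then 1 else 0 := by
  obtain ⟨a, b, s⟩ := t
  obtain ⟨a', b', s'⟩ := t'
  rw [matBasis_apply, matDual_apply, trForm_single_single, mul_comm, MixedTraceDual.mixedTrace_e_mul_eDual]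
  simp only [Prod.mk.injEq]
  by_cases h : a' = a ∧ b' = b
  · rw [if_pos h]
    by_cases hs : s' = s
    · rw [if_pos hs, if_pos ⟨h.1, h.2, hs⟩]
    · rw [if_neg hs, if_neg (fun h' => hs h'.2.2)]
  · rw [if_neg h, if_neg (fun h' => h ⟨h'.1, h'.2.1⟩)]

/-- **Hence `matDual` is THE `B`-dual basis of `matBasis`.** [folklore] -/
theorem dualBasis_matBasis (t : Fin n × Fin n × index K) :
    (trForm n K).dualBasis trForm_nondegenerate (matBasis n K) t = matDual n K t := by
  set x := (trForm n K).dualBasis trForm_nondegenerate (matBasis n K) t - matDual n K t with hx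
  have hfun : trForm n K x = 0 := by
    refine (matBasis n K).ext fun j => ?_
    rw [hx, map_sub, LinearMap.sub_apply, LinearMap.zero_apply,
      LinearMap.BilinForm.apply_dualBasis_left, trForm_matDual_matBasis, sub_self]
  have hx0 : x = 0 := trForm_nondegenerate.1 x fun y => by rw [hfun, LinearMap.zero_apply]
  rw [hx, sub_eq_zero] at hx0
  exact hx0

/-! ### Pushing along an embedding -/

variable {n K}

omit [NumberField K] in
/-- `(E_{ab} x).map f = f(x) E_{ab}` for a real-algebra morphism `f`. [folklore] -/
theorem map_single (f : mixedSpace K →ₐ[ℝ] ℂ) (a b : Fin n) (x : mixedSpace K) :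
    (Matrix.single a b x).map f = f x • Matrix.single a b (1 : ℂ) := by
  ext i j
  simp only [Matrix.map_apply, Matrix.single, Matrix.of_apply, Matrix.smul_apply, smul_eq_mul, mul_ite, mul_one,
    mul_zero, apply_ite f, map_zero]

variable (n K) in
/-- **`X ↦ τ̃(X)` entrywise, `𝔤 → 𝔤𝔩ₙ(ℂ)`**, as a real-linear map. [cite: BorelJacquet1979, §1.1] -/
def mapEmb (τ : K →+* ℂ) : 𝔤 n K →ₗ[ℝ] Matrix (Fin n) (Fin n) ℂ :=
  { toFun := fun X => (X : Matrix (Fin n) (Fin n) (mixedSpace K)).map (embeddingExt τ)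
    map_add' := fun X Y => by rw [coe_add', Matrix.map_add _ (map_add (embeddingExt τ))]
    map_smul' := fun t X => by
      ext i j
      simp only [coe_smul', Matrix.map_apply, Matrix.smul_apply, map_smul, RingHom.id_apply] }

/-- Unfolding. [folklore] -/
@[simp] theorem mapEmb_apply (τ : K →+* ℂ) (X : 𝔤 n K) :
    mapEmb n K τ X = (X : Matrix (Fin n) (Fin n) (mixedSpace K)).map (embeddingExt τ) := rfl

/-! ### The pushed canonical tensor -/

variable (n K) in
/-- **The canonical tensor of the trace form pushed along two embeddings**: for a real-bilinear
`Ψ` on `𝔤𝔩ₙ(ℂ)` which is complex-homogeneous in each variable,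
`∑_t Ψ(τ̃ b_t, τ̃' b^t) = δ_{τ,τ'} ∑_{a,b} Ψ(E_{ab}, E_{ba})` — over the adapted basis `b` of `𝔤`
and its `B`-dual (by basis independence, over ANY basis). [cite: BorelWallach2000, I §2.3] -/
theorem sum_bilin_map_adaptedBasis_dualB {P : Type*} [AddCommGroup P] [Module ℝ P] [Module ℂ P]
    (Ψ : Matrix (Fin n) (Fin n) ℂ →ₗ[ℝ] Matrix (Fin n) (Fin n) ℂ →ₗ[ℝ] P)
    (hΨ₁ : ∀ (c : ℂ) (X Y : Matrix (Fin n) (Fin n) ℂ), Ψ (c • X) Y = c • Ψ X Y)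
    (hΨ₂ : ∀ (c : ℂ) (X Y : Matrix (Fin n) (Fin n) ℂ), Ψ X (c • Y) = c • Ψ X Y) (τ τ' : K →+* ℂ) :
    ∑ t, Ψ (((adaptedBasis n K t : 𝔤 n K) : Matrix (Fin n) (Fin n) (mixedSpace K)).map (embeddingExt τ))
        (((dualB n K t : 𝔤 n K) : Matrix (Fin n) (Fin n) (mixedSpace K)).map (embeddingExt τ')) =
      if τ = τ' then ∑ a : Fin n, ∑ b : Fin n, Ψ (Matrix.single a b 1) (Matrix.single b a 1) else 0 := by
  -- pass to the matrix basis
  set Φ : 𝔤 n K →ₗ[ℝ] 𝔤 n K →ₗ[ℝ] P := (Ψ.comp (mapEmb n K τ)).compl₂ (mapEmb n K τ') with hΦ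
  have hΦapp : ∀ X Y : 𝔤 n K, Φ X Y =
      Ψ ((X : Matrix (Fin n) (Fin n) (mixedSpace K)).map (embeddingExt τ))
        ((Y : Matrix (Fin n) (Fin n) (mixedSpace K)).map (embeddingExt τ')) := fun X Y => rfl
  have key := Literature.Algebra.Lie.sum_basis_dualBasis_eq trForm_nondegenerate trForm_isSymm Φ (adaptedBasis n K)
    (matBasis n K)
  simp only [hΦapp, dualBasis_matBasis] at key
  rw [show (fun t => Ψ (((adaptedBasis n K t : 𝔤 n K) : Matrix (Fin n) (Fin n) (mixedSpace K)).map (embeddingExt τ))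
      (((dualB n K t : 𝔤 n K) : Matrix (Fin n) (Fin n) (mixedSpace K)).map (embeddingExt τ'))) =
      fun t => Ψ (((adaptedBasis n K t : 𝔤 n K) : Matrix (Fin n) (Fin n) (mixedSpace K)).map (embeddingExt τ))
        ((((trForm n K).dualBasis trForm_nondegenerate (adaptedBasis n K) t : 𝔤 n K) :
          Matrix (Fin n) (Fin n) (mixedSpace K)).map (embeddingExt τ')) from rfl, key]
  -- evaluate on the matrix basis
  simp only [Fintype.sum_prod_type]
  have hterm : ∀ (a b : Fin n) (s : index K),
      Ψ (((matBasis n K (a, b, s) : 𝔤 n K) : Matrix (Fin n) (Fin n) (mixedSpace K)).map (embeddingExt τ))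
        (((matDual n K (a, b, s) : 𝔤 n K) : Matrix (Fin n) (Fin n) (mixedSpace K)).map (embeddingExt τ')) =
        (embeddingExt τ (MixedTraceDual.e K s) * embeddingExt τ' (MixedTraceDual.eDual K s)) •
          Ψ (Matrix.single a b 1) (Matrix.single b a 1) := fun a b s => by
    rw [matBasis_apply, matDual_apply, coe_ofMatrix, coe_ofMatrix, map_single, map_single, hΨ₁, hΨ₂, smul_smul]
  simp only [hterm]
  simp only [← Finset.sum_smul, MixedTraceDual.sum_embeddingExt_e_mul_eDual]
  by_cases h : τ = τ'
  · simp only [if_pos h, one_smul]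
  · simp only [if_neg h, zero_smul, Finset.sum_const_zero]

end ResGLnCartan

namespace ConeDictionary

variable (n : ℕ) (K : Type) [Field K] [NumberField K] (hcpt : isCompact_glFiniteIntegralLevel n K)

set_option maxHeartbeats 800000 in
-- one-time re-typing over the datum (definitional)
/-- **The pushed canonical tensor over the datum** (`bD`, `dD`). [cite: BorelWallach2000, I §2.3] -/
theorem sum_bilin_map_bD_dD {P : Type*} [AddCommGroup P] [Module ℝ P] [Module ℂ P]
    (Ψ : Matrix (Fin n) (Fin n) ℂ →ₗ[ℝ] Matrix (Fin n) (Fin n) ℂ →ₗ[ℝ] P)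
    (hΨ₁ : ∀ (c : ℂ) (X Y : Matrix (Fin n) (Fin n) ℂ), Ψ (c • X) Y = c • Ψ X Y)
    (hΨ₂ : ∀ (c : ℂ) (X Y : Matrix (Fin n) (Fin n) ℂ), Ψ X (c • Y) = c • Ψ X Y) (τ τ' : K →+* ℂ) :
    ∑ t, Ψ (((bD n K hcpt t : 𝔤D n K hcpt) : Matrix (Fin n) (Fin n) (mixedSpace K)).map (embeddingExt τ))
        (((dD n K hcpt t : 𝔤D n K hcpt) : Matrix (Fin n) (Fin n) (mixedSpace K)).map (embeddingExt τ')) =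
      if τ = τ' then ∑ a : Fin n, ∑ b : Fin n, Ψ (Matrix.single a b 1) (Matrix.single b a 1) else 0 :=
  ResGLnCartan.sum_bilin_map_adaptedBasis_dualB n K Ψ hΨ₁ hΨ₂ τ τ'

end ConeDictionary

end Literature.NumberTheory.Automorphic

end
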